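import Summits.Ventures.PercRepro.StarGadgetGraphProfiles

/-!
# The pure-pair gadget as a multigraph — definitions and branch profiles (graph half of the pure-pair theorem, modules 1 + 3a)

mine-3's pure-pair theorem (`PercRepro.StarGadget.G_nonneg`, the arithmetic half) is about the
gadget: marks `a b c`, centre `x`, the edge `c – x`, `p, q, r, s` HUBS of the types
`ab, ac, bc, abc`, and `n` PURE PAIRS — two-vertex branches `u ~ v` with `u, v ~ x` and `u, v ~ c`
(five edges).  This module defines that graph in the tree's vocabulary, with the hubs and the pairs
as one family of BRANCHES (`Br := Hub ⊕ Fin n`), each branch carrying its own vertex type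
(`BrVert'`: one vertex for a hub, two for a pair) and edge type (`BrEdge'`: the hub's edges, the
pair's `Fin 5` with `0 = u–v, 1 = x–u, 2 = x–v, 3 = c–u, 4 = c–v`).  The local description of the
bot configurations (`Local`, `Att`, `K`, `XR`) is defined here and characterised in the next module.
-/

namespace PercRepro.PurePairGraph

open StarGadgetGraph

/-- The branch types: a hub type, or the pure pair. -/
abbrev BrType := HubType ⊕ Unit

/-- The branches: the hubs and the `n` pure pairs. -/
abbrev Br (p q r s n : ℕ) := Hub p q r s ⊕ Fin n

/-- The type of a branch. -/
def brType {p q r s n : ℕ} : Br p q r s n → BrType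
  | .inl h => .inl (hubType h)
  | .inr _ => .inr ()

/-- The vertices of a branch type: one for a hub, two (`false = u`, `true = v`) for the pair. -/
def BrVert' : BrType → Type
  | .inl _ => Unit
  | .inr _ => Bool

/-- The edges of a branch type: the hub's edges, or the five edges of the pair. -/
def BrEdge' : BrType → Type
  | .inl T => HubEdge T
  | .inr _ => Fin 5

/-- `BrVert'` is finite. -/
instance (τ : BrType) : Fintype (BrVert' τ) := by
  cases τ <;> (unfold BrVert'; infer_instance)

/-- `BrVert'` has decidable equality. -/
instance (τ : BrType) : DecidableEq (BrVert' τ) := by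
  cases τ <;> (unfold BrVert'; infer_instance)

/-- `BrEdge'` is finite. -/
instance (τ : BrType) : Fintype (BrEdge' τ) := by
  cases τ <;> (unfold BrEdge'; infer_instance)

/-- `BrEdge'` has decidable equality. -/
instance (τ : BrType) : DecidableEq (BrEdge' τ) := by
  cases τ <;> (unfold BrEdge'; infer_instance)

/-- `BrVert'` of a branch is finite (the instance the `Sigma` / `Pi` searches need). -/
instance {p q r s n : ℕ} (b : Br p q r s n) : Fintype (BrVert' (brType b)) := inferInstance

/-- `BrVert'` of a branch has decidable equality. -/
instance {p q r s n : ℕ} (b : Br p q r s n) : DecidableEq (BrVert' (brType b)) := inferInstance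

/-- `BrEdge'` of a branch is finite. -/
instance {p q r s n : ℕ} (b : Br p q r s n) : Fintype (BrEdge' (brType b)) := inferInstance

/-- `BrEdge'` of a branch has decidable equality. -/
instance {p q r s n : ℕ} (b : Br p q r s n) : DecidableEq (BrEdge' (brType b)) := inferInstance

/-- The vertices: the four centrals (`a b c x = 0 1 2 3`) and the branch vertices. -/
abbrev PV (p q r s n : ℕ) := Fin 4 ⊕ Σ b : Br p q r s n, BrVert' (brType b)

/-- The edges: the edge `c – x` and, for every branch, its edges. -/
abbrev PE (p q r s n : ℕ) := Fin 1 ⊕ Σ b : Br p q r s n, BrEdge' (brType b)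

variable {p q r s n : ℕ}

/-- The mark `m` as a vertex. -/
def vm (m : Fin 3) : PV p q r s n := .inl m.castSucc

/-- The centre `x` as a vertex. -/
def vx : PV p q r s n := .inl 3

/-- The vertex of the hub `h`. -/
def hv (h : Hub p q r s) : PV p q r s n := .inr ⟨.inl h, ()⟩

/-- The vertex `w` (`false = u`, `true = v`) of the pair `j`. -/
def pv (j : Fin n) (w : Bool) : PV p q r s n := .inr ⟨.inr j, w⟩

/-- The first endpoints of the five edges of the pair `j`: `u, x, x, c, c`. -/
def pairFst (j : Fin n) : Fin 5 → PV p q r s n := ![pv j false, vx, vx, vm 2, vm 2]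

/-- The second endpoints of the five edges of the pair `j`: `v, u, v, u, v`. -/
def pairSnd (j : Fin n) : Fin 5 → PV p q r s n :=
  ![pv j true, pv j false, pv j true, pv j false, pv j true]

/-- **The pure-pair gadget**: `x ~ c`, `p, q, r, s` hubs and `n` pure pairs. -/
def purePairGadget (p q r s n : ℕ) : MultiGraph (PV p q r s n) (PE p q r s n) where
  fst
    | .inl _ => vm 2
    | .inr ⟨.inl _, none⟩ => vx
    | .inr ⟨.inl h, some i⟩ => vm ((hubType h).marks.get i)
    | .inr ⟨.inr j, k⟩ => pairFst j k
  snd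
    | .inl _ => vx
    | .inr ⟨.inl h, _⟩ => hv h
    | .inr ⟨.inr j, k⟩ => pairSnd j k

/-! ### Projections of a configuration -/

/-- The state of the hub `h`: which of its edges are open. -/
def hubState (ω : Config (PE p q r s n)) (h : Hub p q r s) : HubEdge (hubType h) → Bool :=
  fun j => ω (.inr ⟨.inl h, j⟩)

/-- The state of the pair `j`: which of its five edges are open. -/
def pairState (ω : Config (PE p q r s n)) (j : Fin n) : Fin 5 → Bool :=
  fun k => ω (.inr ⟨.inr j, k⟩)

/-- The edge `x – h` is open. -/
def xOpen (ω : Config (PE p q r s n)) (h : Hub p q r s) : Prop := ω (.inr ⟨.inl h, none⟩) = true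

/-- Some edge `m – h` is open. -/
def markOpen (ω : Config (PE p q r s n)) (h : Hub p q r s) (m : Fin 3) : Prop :=
  ∃ i, (hubType h).marks.get i = m ∧ ω (.inr ⟨.inl h, some i⟩) = true

/-- The edge `c – x` is open. -/
def cxOpen (ω : Config (PE p q r s n)) : Prop := ω (.inl 0) = true

/-! ### The pair vocabulary (on a pair state `s : Fin 5 → Bool`, vertex `w : Bool`) -/

/-- The x-edge of the vertex `w` of a pair is open (`1 = x–u`, `2 = x–v`). -/
def pxo (s : Fin 5 → Bool) (w : Bool) : Prop := s (if w then 2 else 1) = true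

/-- The c-edge of the vertex `w` of a pair is open (`3 = c–u`, `4 = c–v`). -/
def pco (s : Fin 5 → Bool) (w : Bool) : Prop := s (if w then 4 else 3) = true

/-- The edge `u – v` of a pair is open. -/
def puv (s : Fin 5 → Bool) : Prop := s 0 = true

/-- The vertex `w` reaches `x` inside the pair. -/
def xatt (s : Fin 5 → Bool) (w : Bool) : Prop := pxo s w ∨ (puv s ∧ pxo s (!w))

/-- The vertex `w` reaches `c` inside the pair. -/
def catt (s : Fin 5 → Bool) (w : Bool) : Prop := pco s w ∨ (puv s ∧ pco s (!w))

/-- The pair joins `x` to `c`. -/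
def xcPath (s : Fin 5 → Bool) : Prop := ∃ w, pxo s w ∧ catt s w

/-- `pxo` is decidable. -/
instance (s : Fin 5 → Bool) (w : Bool) : Decidable (pxo s w) := by unfold pxo; infer_instance

/-- `pco` is decidable. -/
instance (s : Fin 5 → Bool) (w : Bool) : Decidable (pco s w) := by unfold pco; infer_instance

/-- `puv` is decidable. -/
instance (s : Fin 5 → Bool) : Decidable (puv s) := by unfold puv; infer_instance

/-- `xatt` is decidable. -/
instance (s : Fin 5 → Bool) (w : Bool) : Decidable (xatt s w) := by unfold xatt; infer_instance

/-- `catt` is decidable. -/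
instance (s : Fin 5 → Bool) (w : Bool) : Decidable (catt s w) := by unfold catt; infer_instance

/-- `xcPath` is decidable. -/
instance (s : Fin 5 → Bool) : Decidable (xcPath s) := by unfold xcPath; infer_instance

/-- `xOpen` is decidable. -/
instance (ω : Config (PE p q r s n)) (h : Hub p q r s) : Decidable (xOpen ω h) := by
  unfold xOpen; infer_instance

/-- `markOpen` is decidable. -/
instance (ω : Config (PE p q r s n)) (h : Hub p q r s) (m : Fin 3) : Decidable (markOpen ω h m) := by
  unfold markOpen; infer_instance

/-- `cxOpen` is decidable. -/
instance (ω : Config (PE p q r s n)) : Decidable (cxOpen ω) := by unfold cxOpen; infer_instance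

/-! ### The centrals -/

/-- The centrals `{a, b, c, x}`. -/
def Cen (p q r s n : ℕ) : Set (PV p q r s n) := Set.range Sum.inl

/-- The branch of a vertex (`none` for a central). -/
def br : PV p q r s n → Option (Br p q r s n)
  | .inl _ => none
  | .inr ⟨b, _⟩ => some b

/-- **Fact G1′**: every edge has a central endpoint, or joins two vertices of one branch. -/
theorem cover (e : PE p q r s n) :
    (purePairGadget p q r s n).fst e ∈ Cen p q r s n ∨ (purePairGadget p q r s n).snd e ∈ Cen p q r s n ∨
      br ((purePairGadget p q r s n).fst e) = br ((purePairGadget p q r s n).snd e) := by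
  rcases e with k | ⟨b, j⟩
  · exact Or.inl ⟨2, rfl⟩
  · rcases b with h | j'
    · rcases j with _ | i
      · exact Or.inl ⟨3, rfl⟩
      · exact Or.inl ⟨_, rfl⟩
    · fin_cases j
      · exact Or.inr (Or.inr rfl)
      · exact Or.inl ⟨3, rfl⟩
      · exact Or.inl ⟨3, rfl⟩
      · exact Or.inl ⟨2, rfl⟩
      · exact Or.inl ⟨2, rfl⟩

/-! ### The local description of the bot configurations -/

/-- `x` attaches to the mark `m`: for `m = c` through the edge `c – x` or a pair joining `x` to `c`;
for any `m` through a hub with open `x`-edge and open `m`-edge. -/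
def Att (ω : Config (PE p q r s n)) (m : Fin 3) : Prop :=
  (m = 2 ∧ (cxOpen ω ∨ ∃ j, xcPath (pairState ω j))) ∨ ∃ h, xOpen ω h ∧ markOpen ω h m

/-- `Local ω`: (i) at most one open mark edge per hub; (ii) all hubs with an open `x`-edge carry
the same open mark (if any); (iii′) if `x` is joined to `c` otherwise than through a hub, the hubs
with an open `x`-edge carry no open mark edge except to `c`. -/
def Local (ω : Config (PE p q r s n)) : Prop :=
  (∀ h m m', markOpen ω h m → markOpen ω h m' → m = m') ∧
  (∀ h h' m m', xOpen ω h → xOpen ω h' → markOpen ω h m → markOpen ω h' m' → m = m') ∧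
  ((cxOpen ω ∨ ∃ j, xcPath (pairState ω j)) → ∀ h m, xOpen ω h → markOpen ω h m → m = 2)

/-- The candidate open cluster of the mark `m`: the mark; the hubs hanging from it alone; for
`m = c` the pair vertices reaching `c` inside their pair; and — if `x` attaches to `m` — the centre
with the hubs hanging from it and the pair vertices reaching `x` inside their pair. -/
def K (ω : Config (PE p q r s n)) (m : Fin 3) : Set (PV p q r s n) :=
  {vm m} ∪ {v | ∃ h, v = hv h ∧ ¬ xOpen ω h ∧ markOpen ω h m} ∪
    {v | m = 2 ∧ ∃ j w, v = pv j w ∧ catt (pairState ω j) w} ∪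
    {v | Att ω m ∧ (v = vx ∨ (∃ h, v = hv h ∧ xOpen ω h) ∨ ∃ j w, v = pv j w ∧ xatt (pairState ω j) w)}

/-- The candidate open cluster of the centre when it attaches to no mark. -/
def XR (ω : Config (PE p q r s n)) : Set (PV p q r s n) :=
  {vx} ∪ {v | ∃ h, v = hv h ∧ xOpen ω h} ∪ {v | ∃ j w, v = pv j w ∧ xatt (pairState ω j) w}

/-- `Att` is decidable. -/
instance (ω : Config (PE p q r s n)) (m : Fin 3) : Decidable (Att ω m) := by
  unfold Att; infer_instance

/-- `Local` is decidable. -/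
instance (ω : Config (PE p q r s n)) : Decidable (Local ω) := by
  unfold Local; infer_instance

end PercRepro.PurePairGraph

namespace PercRepro.PurePairGraph

open StarGadgetGraph

/-- The pair states allowed in mode `μ`: any in mode M; otherwise the pair must not join `x` to `c`. -/
def pinA (μ : Mode) (s : Fin 5 → Bool) : Prop := μ = some 2 ∨ ¬ xcPath s

/-- The vertex `w` of a pair lies in the open cluster of the mark `m`: for `m = c` by reaching `c`
inside the pair, or through the centre when `x` attaches to `m`. -/
def pinCl (μ : Mode) (m : Fin 3) (s : Fin 5 → Bool) (w : Bool) : Prop :=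
  (m = 2 ∧ catt s w) ∨ (μ = some m ∧ xatt s w)

/-- The vertex `w` lies in the avoided set `X`. -/
def pinX (μ : Mode) (X : Option (Fin 3)) (s : Fin 5 → Bool) (w : Bool) : Prop :=
  ∃ m, X = some m ∧ pinCl μ m s w

/-- H-adjacency of the central `i` (`a b c x = 0 1 2 3`) to the vertex `w` of a pair. -/
def PHf (μ : Mode) (i : Fin 4) (s : Fin 5 → Bool) (w : Bool) : Prop :=
  if i = 3 then (if μ = some 2 then ¬ pxo s w else pinCl μ 2 s w ∨ xatt s w)
  else if i = 2 then (pinCl μ 2 s w → ¬ pco s w)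
  else if i = 1 then (¬ pinCl μ 2 s w ∧ pinCl μ 1 s w)
  else (¬ pinCl μ 2 s w ∧ pinCl μ 0 s w)

/-- The in-branch H-step `u ~ v` of a pair: a closed `u – v` inside `M`, the edge `u – v` across
the boundary of `M`, or connectivity outside `M` (through `u – v` or through the centre). -/
def PHin (μ : Mode) (s : Fin 5 → Bool) : Prop :=
  (pinCl μ 2 s false ∧ pinCl μ 2 s true ∧ ¬ puv s) ∨
    (pinCl μ 2 s false ↔ ¬ pinCl μ 2 s true) ∨
      (¬ pinCl μ 2 s false ∧ ¬ pinCl μ 2 s true ∧ (puv s ∨ (xatt s false ∧ xatt s true)))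

/-- The pair detour fact of the pair of centrals `(i, j)` avoiding `X`. -/
def PD (μ : Mode) (X : Option (Fin 3)) (i j : Fin 4) (s : Fin 5 → Bool) : Prop :=
  ∃ w, ¬ pinX μ X s w ∧ PHf μ i s w ∧
    (PHf μ j s w ∨ (¬ pinX μ X s (!w) ∧ PHin μ s ∧ PHf μ j s (!w)))

/-- `pinA` is decidable. -/
instance (μ : Mode) (s : Fin 5 → Bool) : Decidable (pinA μ s) := by unfold pinA; infer_instance

/-- `pinCl` is decidable. -/
instance (μ : Mode) (m : Fin 3) (s : Fin 5 → Bool) (w : Bool) : Decidable (pinCl μ m s w) := by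
  unfold pinCl; infer_instance

/-- `pinX` is decidable. -/
instance (μ : Mode) (X : Option (Fin 3)) (s : Fin 5 → Bool) (w : Bool) :
    Decidable (pinX μ X s w) := by
  unfold pinX; infer_instance

/-- `PHf` is decidable. -/
instance (μ : Mode) (i : Fin 4) (s : Fin 5 → Bool) (w : Bool) : Decidable (PHf μ i s w) := by
  unfold PHf; infer_instance

/-- `PHin` is decidable. -/
instance (μ : Mode) (s : Fin 5 → Bool) : Decidable (PHin μ s) := by unfold PHin; infer_instance

/-- `PD` is decidable. -/
instance (μ : Mode) (X : Option (Fin 3)) (i j : Fin 4) (s : Fin 5 → Bool) :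
    Decidable (PD μ X i j s) := by
  unfold PD; infer_instance

/-! ### Branch-typed predicates -/

/-- The allowed states of a branch type in mode `μ`. -/
def bInA (μ : Mode) : (τ : BrType) → (BrEdge' τ → Bool) → Prop
  | .inl T, s => inA μ T s
  | .inr _, s => pinA μ s

/-- The detour fact of the pair of centrals `(i, j)` avoiding `X`, by branch type. -/
def bDpred (μ : Mode) (X : Option (Fin 3)) (i j : Fin 4) :
    (τ : BrType) → (BrEdge' τ → Bool) → Prop
  | .inl T, s => ¬ inX μ X T s ∧ Hf μ i T s ∧ Hf μ j T s
  | .inr _, s => PD μ X i j s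

/-- The mode witness, by branch type: a hub with open `x`-edge and open edge to the mode's mark,
or (mode M) a pair joining `x` to `c`. -/
def bWpred (μ : Mode) : (τ : BrType) → (BrEdge' τ → Bool) → Prop
  | .inl _, s => xo s ∧ ∃ m, μ = some m ∧ mo s m
  | .inr _, s => μ = some 2 ∧ xcPath s

/-- `bInA` is decidable. -/
instance (μ : Mode) (τ : BrType) (s : BrEdge' τ → Bool) : Decidable (bInA μ τ s) := by
  cases τ <;> (unfold bInA; infer_instance)

/-- `bDpred` is decidable. -/
instance (μ : Mode) (X : Option (Fin 3)) (i j : Fin 4) (τ : BrType) (s : BrEdge' τ → Bool) :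
    Decidable (bDpred μ X i j τ s) := by
  cases τ <;> (unfold bDpred; infer_instance)

/-- `bWpred` is decidable. -/
instance (μ : Mode) (τ : BrType) (s : BrEdge' τ → Bool) : Decidable (bWpred μ τ s) := by
  cases τ <;> (unfold bWpred; infer_instance)

/-! ### Sanity values: the pair's allowed states (the bases `32^n` and `16^n` of `G`) -/

/-- Mode M: all 32 pair states; mode K: the 16 states not joining `x` to `c`. -/
example : (Finset.univ.filter fun s : Fin 5 → Bool => pinA (some 2) s).card = 32 ∧
    (Finset.univ.filter fun s : Fin 5 → Bool => pinA (some 0) s).card = 16 := by decide +kernel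

end PercRepro.PurePairGraph
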